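import Summits.QuantumFields.YangMills.Theorems.FluctuationComparisonRegPrIntLS2BetaOneStepL2ClosePair
import Summits.QuantumFields.YangMills.Theorems.FluctuationComparisonRegPrIntLS2BetaOneStepL2ActionOfAverage
import Summits.QuantumFields.YangMills.Theorems.FluctuationComparisonRegPrIntLS2BetaFlatTubeDepthOneUniform
import Summits.QuantumFields.YangMills.Theorems.FluctuationComparisonRegPrIntLS2BetaClosePairOfOneStep
import Literature.MathematicalPhysics.QuantumFieldTheory.Balaban1983to89.T3OneStepAveragingPlaquettes
import Literature.MathematicalPhysics.QuantumFieldTheory.Balaban1983to89.T3CruxEstimates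
import Literature.MathematicalPhysics.QuantumFieldTheory.Balaban1983to89.T3Thresholds
import Literature.MathematicalPhysics.QuantumFieldTheory.Balaban1983to89.TorusGeometry
import HarnessLib

/-!
# GAP♭ AT THE FLAT DATUM AT EVERY DEPTH WITH A VOLUME-UNIFORM CONSTANT, I — THE INDUCTION DOWN THE AVERAGING TOWER: a residual `w` with
# `Σ_ℓ dist1(U ℓ·((w • 1) ℓ)⁻¹)² ≤ β(L)(α(L)+1)^{K−J}·A(U)` for every flat-fibre field of every depth whose history has small plaquettes
# (crux `FluctuationComparisonRegPrIntL`, stmt-QuantumFields-20520; registry v11.4 `Cruxes/FluctuationComparisonRegPrIntL/Lines/semiclassical_s2beta.lean` 3732b7df FROZEN, untouched)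

Cell `ym3-torus` (YM ladder rung R3 = continuum `SU(2)` Yang–Mills on the three-torus — a RUNG: NOT d = 4, NOT infinite volume, NOT a mass gap, NOT Clay).
Width seat `ym3-torus-px12` (gen 22); `--kind proof --supports stmt-QuantumFields-20520 --as helper`, count-neutral, DEFINITION-FREE (0 `def`, 0 `instance`,
0 `notation`, 0 `sorry`, default heartbeats).

WHY.  ✓`…S2BetaFlatTubeDepthOneUniform.tubeGrowth_flat_depthOne_uniform` gives GAP♯∘'s body at `(V, U₀) = (1, 1)` with `μ` before the run, at depth `K − J = 1`.  This file
runs the same kinematics DOWN THE TOWER: for a flat-fibre field `U` of run `K` at depth `m + 1`, the descended field `D_{K−1,K}U` is a flat-fibre field of run `K − 1` at depth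
`m` (✓`descendTo_descendTo`); the induction hypothesis gives a residual `w′` there with `Σ dist1² ≤ C_m·A(D U)`; lifting `w′` to the `1`-block centres of run `K`
(`g := w′ ∘ σ⁻¹ ∘ blockOf`) and gauging `U` comb-axially relative to the pure gauge `g • 1`, the one-level `ℓ²` close-pair bound (✓`…S2BetaOneStepL2ClosePair`) pays the
depth-`m` deviation as the (0.4)-mismatch channel and the plaquettes of `U` as the local channel; `A(D U) ≤ c(L)·A(U)` (✓`…S2BetaOneStepL2ActionOfAverage`) closes the
step.  The constant grows geometrically in the depth — `C_m ≤ β(L)·(α(L) + 1)^m` — and NEVER sees the volume.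

WHAT (d = 3 carrier, `SU(2)`, the family's (0.4) averaging `ℰp`).
* §1 transports: `sum_sq_mismatch_eq_fieldShift` (the mismatch channel at level `1` of run `K + 1` IS the deviation at level `0` of run `K`), `descendTo_gaugeAct_lift` (a lifted
  coarse transformation acts through the descent), guards from `PlaqSmall θ`.
* §2 ★★ `flat_tower` — for `θ` under the guards: `∀ m K J (K − J = m)`, every `U ∈ fibre_{J,K}(1)` all of whose descended fields `D_{i,K}U` (`J ≤ i ≤ K`) have plaquettes `< θ`
  admits a RESIDUAL `w` with `Σ_ℓ dist1(U ℓ·((w • 1) ℓ)⁻¹)² ≤ β(L)(α(L)+1)^{K−J}·wilsonAction4 U`.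
The companion `…S2BetaFlatTubeAllDepthsVolumeUniform` turns this into GAP♯∘'s body at `(1, 1)` under the registry's prefix with `μ(L, K − J)` before the run.

HONEST: the flat datum only; `μ(L, m)` decays geometrically in the depth `m` — the DEPTH-uniformity of TUBE-REG∘∕GAP♯∘ ([Balaban1984PropagatorsII] (1.33), multi-scale) is NOT
touched, only the volume-uniformity at every fixed depth; constants crude; lattice kinematics + Cauchy–Schwarz; nothing of Bałaban's analysis; TUBE-REG∘, GAP♯∘, EXW∘, S2β,
crux 20520 NOT proved; no registered stub is closed; rung R3 = SU(2) YM₃ on T³ — NOT d = 4, NOT infinite volume, NOT a mass gap, NOT Clay; the Yang–Mills mass gap is NOT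
proved.  Sorry-free, axioms standard.

References: T. Bałaban, CMP **99** (1985) 75–102 [Balaban1985RegularSpaces] (Lemma 1 (1.24)–(1.26) pp.79–80); CMP **102** (1985) 277–309 [Balaban1985Variational]
((142) p.299); CMP **96** (1984) 223–250 [Balaban1984PropagatorsII] ((1.33)); CMP **102** (1985) 255–275 [Balaban1985UV3] ((11) p.258, (12)–(13) p.259); CMP **109** (1987)
249–301 [Balaban1987RG1] ((0.4), (0.11) p.253).
-/

set_option autoImplicit false

noncomputable section

namespace Summit.QuantumFields.YangMills.Theorems.FluctuationComparisonRegPrIntLS2BetaFlatTubeTowerStep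

open Finset
open Literature.MathematicalPhysics.QuantumFieldTheory.Balaban1983to89
open T4Continuum BlockAveraging AveragingRT ExpMeanLog
open T3ContinuumYM3Torus
open T3UnitLawDensityEML (ℰp)
open T3UnitScaleTilt T3TiltDescent T3LevelShift
open T3ConstrainedMinimiser (fibre)
open T3PrintedRegularMinimiser
open T3PrintedMinimiserExistence (plaqSmall_of_le)
open T3DescentFibreTower (avgFun_one expMeanLogSU_E_one descendTo_descendTo descendTo_self)
open T3OneStepAveragingPlaquettes (descendTo_succ)
open T3CruxEstimates (plaqSmall_fieldShift)
open T3Thresholds (exists_gamma_forall_θBal_le)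
open T3MinimiserStabilityReduction (θBal_pos)
open B10Eq27TorusAxialLog (axialT gaugeActT gaugeActT_eq_gaugeAct)
open B5Eq118OneStroke (iterBlockOf)
open B15DeterminingSets (embIter)
open B3Taylor310LocalRemainder (tdist_comm tdist_self tdist_triangle)
open Summit.QuantumFields.YangMills.Theorems.Prop7AxialGauge (exists_axialGauge)
open Summit.QuantumFields.YangMills.Theorems.FluctuationComparisonRegPrIntLS2BetaDetRepLocalRows (card_filter_tdist_comp_le)
open Summit.QuantumFields.YangMills.Theorems.FluctuationComparisonRegPrIntLS2BetaOneStepLocalAxialBounds (tdist_centre_le)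
open Summit.QuantumFields.YangMills.Theorems.FluctuationComparisonRegPrIntLS2BetaFlatTubeDepthOneUniformTorus
open Summit.QuantumFields.YangMills.Theorems.FluctuationComparisonRegPrIntLS2BetaFlatTubeDepthOneUniform (sum_ball_gaugeAct sum_ball_le_of_plaqSmall)
open Summit.QuantumFields.YangMills.Theorems.FluctuationComparisonRegPrIntLS2BetaOneStepL2ClosePair (sum_dist1_mul_inv_sq_le)
open Summit.QuantumFields.YangMills.Theorems.FluctuationComparisonRegPrIntLS2BetaOneStepL2ActionOfAverage (near_tdist_le wilsonAction4_avg_le)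

open scoped Matrix.Norms.L2Operator

/-! ## §1 Transports and guards -/

section Transport

variable {P : Params}

/-- A ball square sum with a pure-gauge partner equals the field's own ball square sum. [cite: Balaban1985Averaging, (8)-(9) p.19] -/
theorem sum_ball_pair_pureGauge {G : Type*} [GaugeGroup G] (U : GaugeField P 0 G) (g : GaugeTransf P 0 G) (c : Site P 0) (R : ℕ) :
    ∑ q ∈ univ.filter (fun q : Plaq P 0 => Site.tdist q.src c ≤ R),
        (dist1 (GaugeField.plaqHol U q) ^ 2 + dist1 (GaugeField.plaqHol (GaugeField.gaugeAct g (1 : GaugeField P 0 G)) q) ^ 2) =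
      ∑ q ∈ univ.filter (fun q : Plaq P 0 => Site.tdist q.src c ≤ R), dist1 (GaugeField.plaqHol U q) ^ 2 := by
  refine Finset.sum_congr rfl fun q _ => ?_
  have h1 : GaugeField.plaqHol (1 : GaugeField P 0 G) q = 1 := by
    show (1 : G) * 1 * (1 : G)⁻¹ * (1 : G)⁻¹ = 1; simp
  rw [T4WilsonGaugeFlatDirection.plaqHol_gaugeAct, GaugeGroup.dist1_conj, h1, GaugeGroup.dist1_one]
  ring

/-- At most `d²(2dL+1)^d` plaquettes are based in one block (crude, volume-free). [cite: Balaban1987RG1, (0.3) p.252] -/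
theorem card_filter_plaq_blockOf_le (hk : 1 ≤ P.m + P.K) (y : Site P 1) :
    (univ.filter fun q : Plaq P 0 => blockOf q.src = y).card ≤ P.d ^ 2 * (2 * (P.d * P.L) + 1) ^ P.d := by
  classical
  refine le_trans (Finset.card_le_card fun q hq => ?_)
    (card_filter_tdist_comp_le (fun q : Plaq P 0 => q.src) (m := P.d ^ 2) card_filter_plaq_src_eq_le (emb y) (P.d * P.L))
  rw [Finset.mem_filter] at hq ⊢
  refine ⟨Finset.mem_univ _, ?_⟩
  have h := tdist_centre_le (k := 1) hk q.src
  rw [pow_one, tdist_comm] at h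
  have hb : iterBlockOf 1 q.src = y := hq.2
  rw [hb] at h
  exact h

/-- Under `PlaqSmall θ` the near-sum of a coarse plaquette is at most `d²(2dL+1)^d·d²(2d+1)^d·θ²`. [cite: Balaban1987RG1, (0.18) p.255] -/
theorem sum_near_le_of_plaqSmall {G : Type*} [GaugeGroup G] (hk : 1 ≤ P.m + P.K) (U : GaugeField P 0 G) {θ : ℝ} (hU : PlaqSmall θ U) (p : Plaq P 1) :
    ∑ q ∈ univ.filter (fun q : Plaq P 0 => ∀ κ, blockOf q.src κ = p.src κ ∨ blockOf q.src κ = p.src κ + 1 ∨ blockOf q.src κ = p.src κ - 1),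
        dist1 (GaugeField.plaqHol U q) ^ 2 ≤ ((P.d ^ 2 * (2 * (P.d * P.L) + 1) ^ P.d * (2 * P.d + 1) ^ P.d : ℕ) : ℝ) * θ ^ 2 := by
  classical
  have hcard : (univ.filter fun q : Plaq P 0 => ∀ κ, blockOf q.src κ = p.src κ ∨ blockOf q.src κ = p.src κ + 1 ∨ blockOf q.src κ = p.src κ - 1).card ≤
      P.d ^ 2 * (2 * (P.d * P.L) + 1) ^ P.d * (2 * P.d + 1) ^ P.d := by
    refine le_trans (Finset.card_le_card fun q hq => ?_)
      (card_filter_tdist_comp_le (fun q : Plaq P 0 => blockOf q.src) (m := P.d ^ 2 * (2 * (P.d * P.L) + 1) ^ P.d)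
        (card_filter_plaq_blockOf_le hk) p.src P.d)
    rw [Finset.mem_filter] at hq ⊢
    refine ⟨Finset.mem_univ _, ?_⟩
    rw [tdist_comm]
    exact near_tdist_le hq.2
  calc ∑ q ∈ univ.filter (fun q : Plaq P 0 => ∀ κ, blockOf q.src κ = p.src κ ∨ blockOf q.src κ = p.src κ + 1 ∨ blockOf q.src κ = p.src κ - 1),
        dist1 (GaugeField.plaqHol U q) ^ 2
      ≤ ∑ _q ∈ univ.filter (fun q : Plaq P 0 => ∀ κ, blockOf q.src κ = p.src κ ∨ blockOf q.src κ = p.src κ + 1 ∨ blockOf q.src κ = p.src κ - 1), θ ^ 2 :=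
        Finset.sum_le_sum fun q _ => pow_le_pow_left₀ (GaugeGroup.dist1_nonneg _) (hU q).le 2
    _ ≤ _ := by
        rw [Finset.sum_const, nsmul_eq_mul]
        refine mul_le_mul_of_nonneg_right ?_ (sq_nonneg _)
        exact_mod_cast hcard

end Transport

/-- The arithmetic of one induction step: `C_{m+1} = 2N_B·c_A·C_m + 8C²M ≤ 8C²M·(2N_B c_A + 1)^{m+1}`. [folklore] -/
theorem step_arith {S Mi Pl A A' Csq Mr NBr cA : ℝ} (m : ℕ) (hCsq : 0 ≤ Csq) (hMr : 0 ≤ Mr) (hNBr : 0 ≤ NBr) (hcA : 0 ≤ cA)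
    (hA : 0 ≤ A) (hS : S ≤ 2 * NBr * Mi + 2 * Csq * (Mr * Pl)) (hMi : Mi ≤ 8 * (Csq * Mr) * (2 * NBr * cA + 1) ^ m * A')
    (hPl : Pl ≤ 4 * A) (hA' : A' ≤ cA * A) :
    S ≤ 8 * (Csq * Mr) * (2 * NBr * cA + 1) ^ (m + 1) * A := by
  have h2N : (0 : ℝ) ≤ 2 * NBr := by linarith
  have h2C : (0 : ℝ) ≤ 2 * Csq := by linarith
  have hpow : (0 : ℝ) ≤ (2 * NBr * cA + 1) ^ m := pow_nonneg (by nlinarith) m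
  have hK : (0 : ℝ) ≤ 8 * (Csq * Mr) * (2 * NBr * cA + 1) ^ m := by positivity
  have h1 : 2 * NBr * Mi ≤ 2 * NBr * (8 * (Csq * Mr) * (2 * NBr * cA + 1) ^ m * (cA * A)) :=
    mul_le_mul_of_nonneg_left (hMi.trans (mul_le_mul_of_nonneg_left hA' hK)) h2N
  have h3 : 2 * Csq * (Mr * Pl) ≤ 2 * Csq * (Mr * (4 * A)) := mul_le_mul_of_nonneg_left (mul_le_mul_of_nonneg_left hPl hMr) h2C
  have hgrow : 2 * NBr * cA * (2 * NBr * cA + 1) ^ m + 1 ≤ (2 * NBr * cA + 1) ^ (m + 1) := by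
    have h1' : (1 : ℝ) ≤ (2 * NBr * cA + 1) ^ m := one_le_pow₀ (by nlinarith)
    rw [pow_succ]
    nlinarith
  have hCM : (0 : ℝ) ≤ 8 * (Csq * Mr) * A := by positivity
  calc S ≤ 2 * NBr * Mi + 2 * Csq * (Mr * Pl) := hS
    _ ≤ 2 * NBr * (8 * (Csq * Mr) * (2 * NBr * cA + 1) ^ m * (cA * A)) + 2 * Csq * (Mr * (4 * A)) := add_le_add h1 h3
    _ = 8 * (Csq * Mr) * A * (2 * NBr * cA * (2 * NBr * cA + 1) ^ m + 1) := by ring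
    _ ≤ 8 * (Csq * Mr) * A * (2 * NBr * cA + 1) ^ (m + 1) := mul_le_mul_of_nonneg_left hgrow hCM
    _ = 8 * (Csq * Mr) * (2 * NBr * cA + 1) ^ (m + 1) * A := by ring


/-! ## §2 The induction down the tower -/

section Tower

variable (F : T3Family)

/-- **THE MISMATCH CHANNEL IS THE COARSE DEVIATION**: for `g := w′ ∘ σ⁻¹ ∘ blockOf` (the lift of a transformation `w′` of run `K` to the `1`-block centres of run `K + 1`),
`Σ_c dist1(Ū c·((g∘emb) • 1) c⁻¹)² = Σ_{ℓ′} dist1((D U) ℓ′·((w′ • 1) ℓ′)⁻¹)²` (✓`descendTo_succ`, `bondShift`). [cite: Balaban1987RG1, (0.11) p.253] -/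
theorem sum_sq_mismatch_eq (K : ℕ) (U : GaugeField (F.P (K + 1)) 0 (Matrix.specialUnitaryGroup (Fin 2) ℂ))
    (w' : Site (F.P K) 0 → Matrix.specialUnitaryGroup (Fin 2) ℂ) :
    ∑ c : PBond (F.P (K + 1)) 1, dist1 (avgFun ℰp U c *
        ((GaugeField.gaugeAct (fun y : Site (F.P (K + 1)) 1 =>
          w' ((siteShift (F.sitesPerDir_eq (m := F.m) (K := K) (j := 0) (m' := F.m) (K' := K + 1) (j' := 1) (by omega))).symm y))
          (1 : GaugeField (F.P (K + 1)) 1 (Matrix.specialUnitaryGroup (Fin 2) ℂ))) c)⁻¹) ^ 2 =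
      ∑ ℓ : PBond (F.P K) 0, dist1 (descendTo F ℰp K (K + 1) (Nat.le_succ K) U ℓ *
        ((GaugeField.gaugeAct w' (1 : GaugeField (F.P K) 0 (Matrix.specialUnitaryGroup (Fin 2) ℂ))) ℓ)⁻¹) ^ 2 := by
  set h := F.sitesPerDir_eq (m := F.m) (K := K) (j := 0) (m' := F.m) (K' := K + 1) (j' := 1) (by omega) with hh
  rw [descendTo_succ]
  symm
  refine Fintype.sum_equiv (bondShift h) _ _ fun ℓ => ?_
  have h1 : (GaugeField.gaugeAct w' (1 : GaugeField (F.P K) 0 (Matrix.specialUnitaryGroup (Fin 2) ℂ))) ℓ =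
      (GaugeField.gaugeAct (fun y : Site (F.P (K + 1)) 1 => w' ((siteShift h).symm y))
        (1 : GaugeField (F.P (K + 1)) 1 (Matrix.specialUnitaryGroup (Fin 2) ℂ))) (bondShift h ℓ) := by
    show w' ℓ.src * 1 * (w' ℓ.tgt)⁻¹ =
      w' ((siteShift h).symm (bondShift h ℓ).src) * 1 * (w' ((siteShift h).symm (bondShift h ℓ).tgt))⁻¹
    rw [bondShift_tgt, bondShift_src, Equiv.symm_apply_apply, Equiv.symm_apply_apply]
  rw [fieldShift_apply, blockAvg_avg, h1]
  rfl

/-- ★★ **THE FLAT TOWER.**  Fix `θ ≥ 0` under the two guards (one-level close-pair, averaged action).  For every depth `m` and every `J ≤ K` with `K − J = m`: a field `U` of run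
`K` in the flat fibre `fibre_{J,K}(1)` all of whose descended fields `D_{i,K}U` (`J ≤ i ≤ K`) have plaquettes `< θ` admits a RESIDUAL transformation `w` (`D_{J,K}(w • ·) =
D_{J,K}`) with `Σ_ℓ dist1(U ℓ·((w • 1) ℓ)⁻¹)² ≤ β·(α + 1)^m·wilsonAction4 U`, `α, β` explicit functions of `d = 3` and `L`.
[cite: Balaban1985RegularSpaces, Lemma 1 (1.24)-(1.26) pp.79-80; Balaban1985UV3, (12)-(13) p.259; Balaban1987RG1, (0.11) p.253] -/
theorem flat_tower {θ : ℝ} (hθ0 : 0 ≤ θ)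
    (hθ1 : ∀ K : ℕ, Real.sqrt ((((F.P K).d ^ 2 * (2 * (2 * (F.P K).d * (F.P K).L + (F.P K).L) + 1) ^ (F.P K).d : ℕ) : ℝ)) * θ <
      deltaSU (Fin 2) / (((((F.P K).d + 2) * (F.P K).L : ℕ) : ℝ) ^ 2 / 4))
    (hθ2 : ∀ K : ℕ, Real.sqrt ((((F.P K).d ^ 2 * (2 * ((F.P K).d * (F.P K).L) + 1) ^ (F.P K).d * (2 * (F.P K).d + 1) ^ (F.P K).d : ℕ) : ℝ)) * θ <
      deltaSU (Fin 2) / (((((F.P K).d + 2) * (F.P K).L : ℕ) : ℝ) ^ 2 / 4)) :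
    ∀ (m K J : ℕ) (hJK : J ≤ K), K - J = m → ∀ U : GaugeField (F.P K) 0 (Matrix.specialUnitaryGroup (Fin 2) ℂ),
      U ∈ fibre F ℰp J K hJK (1 : GaugeField (F.P J) 0 (Matrix.specialUnitaryGroup (Fin 2) ℂ)) →
      (∀ (i : ℕ) (hJi : J ≤ i) (hiK : i ≤ K), PlaqSmall θ (descendTo F ℰp i K hiK U)) →
      ∃ w : Site (F.P K) 0 → Matrix.specialUnitaryGroup (Fin 2) ℂ,
        (∀ U'' : GaugeField (F.P K) 0 (Matrix.specialUnitaryGroup (Fin 2) ℂ),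
          descendTo F ℰp J K hJK (GaugeField.gaugeAct w U'') = descendTo F ℰp J K hJK U'') ∧
        ∑ ℓ : PBond (F.P K) 0, dist1 (U ℓ * ((GaugeField.gaugeAct w (1 : GaugeField (F.P K) 0 (Matrix.specialUnitaryGroup (Fin 2) ℂ))) ℓ)⁻¹) ^ 2 ≤
          8 * ((2 * (((3 : ℕ) : ℝ) * (F.L : ℝ)) ^ 2 + 2 * (6 * ((((3 + 2) * F.L : ℕ) : ℝ) ^ 2 / 4)) + ((3 * ((F.L - 1) / 2) : ℕ) : ℝ) * (4 * (((3 : ℕ) : ℝ) * (F.L : ℝ)) ^ 2 + 2)) ^ 2 * ((3 * (2 * (2 * 3 * F.L + F.L + 3 * F.L) + 1) ^ 3 : ℕ) : ℝ)) * (2 * ((3 * (2 * (3 * F.L) + 1) ^ 3 : ℕ) : ℝ) * (((2 : ℕ) : ℝ) * (((F.L : ℝ) ^ 2 + 6 * (((3 + 2) * F.L : ℕ) : ℝ) ^ 2) ^ 2 * ((3 ^ 2 * (2 * 3 + 1) ^ 3 : ℕ) : ℝ))) + 1) ^ m *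
          wilsonAction4 U := by
  intro m
  induction m with
  | zero =>
    intro K J hJK hm U hU _
    have hKJ : K = J := by omega
    subst hKJ
    refine ⟨fun _ => 1, fun U'' => by rw [B12RTGaugeInvariance254.gaugeAct_one'], ?_⟩
    have hU1 : U = 1 := by
      have h := hU
      change descendTo F ℰp K K hJK U = 1 at h
      rwa [show hJK = le_rfl from rfl, descendTo_self] at h
    subst hU1
    have h0 : ∑ ℓ : PBond (F.P K) 0, dist1 ((1 : GaugeField (F.P K) 0 (Matrix.specialUnitaryGroup (Fin 2) ℂ)) ℓ *
        ((GaugeField.gaugeAct (fun _ => (1 : Matrix.specialUnitaryGroup (Fin 2) ℂ)) (1 : GaugeField (F.P K) 0 (Matrix.specialUnitaryGroup (Fin 2) ℂ))) ℓ)⁻¹) ^ 2 = 0 := by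
      refine Finset.sum_eq_zero fun ℓ _ => ?_
      rw [B12RTGaugeInvariance254.gaugeAct_one']
      show dist1 ((1 : Matrix.specialUnitaryGroup (Fin 2) ℂ) * (1 : Matrix.specialUnitaryGroup (Fin 2) ℂ)⁻¹) ^ 2 = 0
      rw [inv_one, mul_one, GaugeGroup.dist1_one]; ring
    rw [h0]
    exact mul_nonneg (by positivity) (wilsonAction4_nonneg _)
  | succ m ih =>
    intro K J hJK hm U hU hsmall
    obtain ⟨K₀, rfl⟩ : ∃ K₀, K = K₀ + 1 := ⟨K - 1, by omega⟩
    have hJK₀ : J ≤ K₀ := by omega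
    have hm₀ : K₀ - J = m := by omega
    have hk : 1 ≤ (F.P (K₀ + 1)).m + (F.P (K₀ + 1)).K := by show 1 ≤ F.m + (K₀ + 1); omega
    have hd : (F.P (K₀ + 1)).d = 3 := T3Family.P_d F (K₀ + 1)
    have hL : (F.P (K₀ + 1)).L = F.L := rfl
    set h := F.sitesPerDir_eq (m := F.m) (K := K₀) (j := 0) (m' := F.m) (K' := K₀ + 1) (j' := 1) (by omega) with hh
    -- the descended field and the induction hypothesis
    set U' : GaugeField (F.P K₀) 0 (Matrix.specialUnitaryGroup (Fin 2) ℂ) := descendTo F ℰp K₀ (K₀ + 1) (Nat.le_succ K₀) U with hU'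
    have hU'f : U' ∈ fibre F ℰp J K₀ hJK₀ (1 : GaugeField (F.P J) 0 (Matrix.specialUnitaryGroup (Fin 2) ℂ)) := by
      show descendTo F ℰp J K₀ hJK₀ (descendTo F ℰp K₀ (K₀ + 1) (Nat.le_succ K₀) U) = 1
      rw [descendTo_descendTo]
      exact hU
    have hsmall' : ∀ (i : ℕ) (hJi : J ≤ i) (hiK : i ≤ K₀), PlaqSmall θ (descendTo F ℰp i K₀ hiK U') := by
      intro i hJi hiK
      rw [hU', descendTo_descendTo]
      exact hsmall i hJi (by omega)
    obtain ⟨w', hres', hsum'⟩ := ih K₀ J hJK₀ hm₀ U' hU'f hsmall'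
    -- the finest plaquettes of `U`
    have hUθ : PlaqSmall θ U := by
      have h1 := hsmall (K₀ + 1) (by omega) le_rfl
      rwa [descendTo_self] at h1
    -- the lift `g` of `w′` and the pure gauge `Y := g • 1`; the comb-axial gauge of `U` relative to `Y`
    set g : Site (F.P (K₀ + 1)) 0 → Matrix.specialUnitaryGroup (Fin 2) ℂ := fun x => w' ((siteShift h).symm (blockOf x)) with hg
    set Y : GaugeField (F.P (K₀ + 1)) 0 (Matrix.specialUnitaryGroup (Fin 2) ℂ) := GaugeField.gaugeAct g 1 with hY
    obtain ⟨v, hv1, hax⟩ := exists_axialGauge (P := F.P (K₀ + 1)) (k := 1) hk Y U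
    set W : GaugeField (F.P (K₀ + 1)) 0 (Matrix.specialUnitaryGroup (Fin 2) ℂ) := GaugeField.gaugeAct v U with hW
    have haxW : ∀ x, axialT W (embIter 1 (iterBlockOf 1 x)) x = axialT Y (embIter 1 (iterBlockOf 1 x)) x := by
      intro x; rw [hW, ← gaugeActT_eq_gaugeAct]; exact hax x
    have hvemb : (fun y : Site (F.P (K₀ + 1)) 1 => v (emb y)) = fun _ => 1 := funext fun y => hv1 y
    have hgemb : (fun y : Site (F.P (K₀ + 1)) 1 => g (emb y)) = fun y => w' ((siteShift h).symm y) := by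
      funext y
      have hb : blockOf (emb y) = y := Site.blockOf_emb (show 0 + 1 ≤ (F.P (K₀ + 1)).m + (F.P (K₀ + 1)).K from hk) y
      show w' ((siteShift h).symm (blockOf (emb y))) = w' ((siteShift h).symm y)
      exact congrArg (fun z => w' ((siteShift h).symm z)) hb
    -- the one-level `ℓ²` close-pair bound for `(W, Y)`
    have hT : ∀ y : Site (F.P (K₀ + 1)) 1, Real.sqrt (∑ q ∈ univ.filter (fun q : Plaq (F.P (K₀ + 1)) 0 =>
        Site.tdist q.src (emb y) ≤ 2 * (F.P (K₀ + 1)).d * (F.P (K₀ + 1)).L + (F.P (K₀ + 1)).L),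
        (dist1 (GaugeField.plaqHol W q) ^ 2 + dist1 (GaugeField.plaqHol Y q) ^ 2)) <
        deltaSU (Fin 2) / (((((F.P (K₀ + 1)).d + 2) * (F.P (K₀ + 1)).L : ℕ) : ℝ) ^ 2 / 4) := by
      intro y
      rw [hY, sum_ball_pair_pureGauge, hW, sum_ball_gaugeAct]
      have hle := sum_ball_le_of_plaqSmall U hUθ (emb y) (2 * (F.P (K₀ + 1)).d * (F.P (K₀ + 1)).L + (F.P (K₀ + 1)).L)
      have hsq : Real.sqrt (∑ q ∈ univ.filter (fun q : Plaq (F.P (K₀ + 1)) 0 =>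
          Site.tdist q.src (emb y) ≤ 2 * (F.P (K₀ + 1)).d * (F.P (K₀ + 1)).L + (F.P (K₀ + 1)).L), dist1 (GaugeField.plaqHol U q) ^ 2) ≤
          Real.sqrt ((((F.P (K₀ + 1)).d ^ 2 * (2 * (2 * (F.P (K₀ + 1)).d * (F.P (K₀ + 1)).L + (F.P (K₀ + 1)).L) + 1) ^ (F.P (K₀ + 1)).d : ℕ) : ℝ)) * θ := by
        rw [← Real.sqrt_sq hθ0, ← Real.sqrt_mul (Nat.cast_nonneg _)]
        exact Real.sqrt_le_sqrt hle
      exact hsq.trans_lt (hθ1 (K₀ + 1))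
    have hpair := sum_dist1_mul_inv_sq_le hk W Y haxW hT
    rw [hd, hL] at hpair
    -- the mismatch channel = the coarse deviation (≤ C_m·A(U′)); the plaquette channel = 4·A(U)
    have havgW : avgFun ℰp W = avgFun ℰp U := by
      rw [← blockAvg_avg, hW, (BlockAveraging.blockAvg (P := F.P (K₀ + 1)) (j := 0) ℰp).covariant hk v U, hvemb]
      exact B12RTGaugeInvariance254.gaugeAct_one' _
    have havgY : avgFun ℰp Y = GaugeField.gaugeAct (fun y : Site (F.P (K₀ + 1)) 1 => w' ((siteShift h).symm y))
        (1 : GaugeField (F.P (K₀ + 1)) 1 (Matrix.specialUnitaryGroup (Fin 2) ℂ)) := by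
      rw [← blockAvg_avg, hY, (BlockAveraging.blockAvg (P := F.P (K₀ + 1)) (j := 0) ℰp).covariant hk g 1, hgemb, blockAvg_avg,
        avgFun_one _ expMeanLogSU_E_one]
      rfl
    have hmis : ∑ c : PBond (F.P (K₀ + 1)) 1, dist1 (avgFun ℰp W c * (avgFun ℰp Y c)⁻¹) ^ 2 ≤
        8 * ((2 * (((3 : ℕ) : ℝ) * (F.L : ℝ)) ^ 2 + 2 * (6 * ((((3 + 2) * F.L : ℕ) : ℝ) ^ 2 / 4)) + ((3 * ((F.L - 1) / 2) : ℕ) : ℝ) * (4 * (((3 : ℕ) : ℝ) * (F.L : ℝ)) ^ 2 + 2)) ^ 2 * ((3 * (2 * (2 * 3 * F.L + F.L + 3 * F.L) + 1) ^ 3 : ℕ) : ℝ)) * (2 * ((3 * (2 * (3 * F.L) + 1) ^ 3 : ℕ) : ℝ) * (((2 : ℕ) : ℝ) * (((F.L : ℝ) ^ 2 + 6 * (((3 + 2) * F.L : ℕ) : ℝ) ^ 2) ^ 2 * ((3 ^ 2 * (2 * 3 + 1) ^ 3 : ℕ) : ℝ))) + 1) ^ m * wilsonAction4 U' := by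
      rw [havgW, havgY, sum_sq_mismatch_eq F K₀ U w']
      exact hsum'
    have hplaq : ∑ q : Plaq (F.P (K₀ + 1)) 0, (dist1 (GaugeField.plaqHol W q) ^ 2 + dist1 (GaugeField.plaqHol Y q) ^ 2) ≤ 4 * wilsonAction4 U := by
      have h1 : ∑ q : Plaq (F.P (K₀ + 1)) 0, (dist1 (GaugeField.plaqHol W q) ^ 2 + dist1 (GaugeField.plaqHol Y q) ^ 2) =
          ∑ q : Plaq (F.P (K₀ + 1)) 0, dist1 (GaugeField.plaqHol U q) ^ 2 := by
        refine Finset.sum_congr rfl fun q _ => ?_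
        have e1 : GaugeField.plaqHol (1 : GaugeField (F.P (K₀ + 1)) 0 (Matrix.specialUnitaryGroup (Fin 2) ℂ)) q = 1 := by
          show (1 : Matrix.specialUnitaryGroup (Fin 2) ℂ) * 1 * (1 : Matrix.specialUnitaryGroup (Fin 2) ℂ)⁻¹ * (1 : Matrix.specialUnitaryGroup (Fin 2) ℂ)⁻¹ = 1
          simp
        rw [hW, hY, T4WilsonGaugeFlatDirection.plaqHol_gaugeAct, GaugeGroup.dist1_conj, T4WilsonGaugeFlatDirection.plaqHol_gaugeAct,
          GaugeGroup.dist1_conj, e1, GaugeGroup.dist1_one]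
        ring
      rw [h1]
      exact sum_dist1_sq_plaq_le_four_mul_wilsonAction4 U
    -- the averaged action
    have hA' : wilsonAction4 U' ≤ (((2 : ℕ) : ℝ) * (((F.L : ℝ) ^ 2 + 6 * (((3 + 2) * F.L : ℕ) : ℝ) ^ 2) ^ 2 * ((3 ^ 2 * (2 * 3 + 1) ^ 3 : ℕ) : ℝ))) * wilsonAction4 U := by
      have hT2 : ∀ p : Plaq (F.P (K₀ + 1)) (0 + 1), Real.sqrt (∑ q ∈ univ.filter (fun q : Plaq (F.P (K₀ + 1)) 0 =>
          ∀ κ, blockOf q.src κ = p.src κ ∨ blockOf q.src κ = p.src κ + 1 ∨ blockOf q.src κ = p.src κ - 1), dist1 (GaugeField.plaqHol U q) ^ 2) <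
          deltaSU (Fin 2) / (((((F.P (K₀ + 1)).d + 2) * (F.P (K₀ + 1)).L : ℕ) : ℝ) ^ 2 / 4) := by
        intro p
        have hle := sum_near_le_of_plaqSmall hk U hUθ p
        have hsq : Real.sqrt (∑ q ∈ univ.filter (fun q : Plaq (F.P (K₀ + 1)) 0 =>
            ∀ κ, blockOf q.src κ = p.src κ ∨ blockOf q.src κ = p.src κ + 1 ∨ blockOf q.src κ = p.src κ - 1), dist1 (GaugeField.plaqHol U q) ^ 2) ≤
            Real.sqrt ((((F.P (K₀ + 1)).d ^ 2 * (2 * ((F.P (K₀ + 1)).d * (F.P (K₀ + 1)).L) + 1) ^ (F.P (K₀ + 1)).d *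
              (2 * (F.P (K₀ + 1)).d + 1) ^ (F.P (K₀ + 1)).d : ℕ) : ℝ)) * θ := by
          rw [← Real.sqrt_sq hθ0, ← Real.sqrt_mul (Nat.cast_nonneg _)]
          exact Real.sqrt_le_sqrt hle
        exact hsq.trans_lt (hθ2 (K₀ + 1))
      have h1 := wilsonAction4_avg_le (N := 2) hk U hT2
      rw [hd, hL] at h1
      rw [hU', descendTo_succ]
      exact (wilsonAction4_fieldShift _ _).trans_le h1
    -- the transformation `w := v⁻¹·g`
    refine ⟨fun x => (v x)⁻¹ * g x, ?_, ?_⟩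
    · -- residual: through the descent `w` acts as `w′` on run `K₀`
      intro U''
      have hwemb : (fun y : Site (F.P (K₀ + 1)) 1 => (v (emb y))⁻¹ * g (emb y)) = fun y => w' ((siteShift h).symm y) := by
        funext y
        rw [show v (emb y) = 1 from hv1 y, inv_one, one_mul]
        exact congrFun hgemb y
      have hcov : (BlockAveraging.blockAvg (P := F.P (K₀ + 1)) (j := 0) ℰp).avg (GaugeField.gaugeAct (fun x => (v x)⁻¹ * g x) U'') =
          GaugeField.gaugeAct (fun y : Site (F.P (K₀ + 1)) 1 => w' ((siteShift h).symm y))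
            ((BlockAveraging.blockAvg (P := F.P (K₀ + 1)) (j := 0) ℰp).avg U'') := by
        have hc := (BlockAveraging.blockAvg (P := F.P (K₀ + 1)) (j := 0) ℰp).covariant hk (fun x => (v x)⁻¹ * g x) U''
        rw [hc]
        exact congrArg (fun u => GaugeField.gaugeAct u ((BlockAveraging.blockAvg (P := F.P (K₀ + 1)) (j := 0) ℰp).avg U'')) hwemb
      have hstep : descendTo F ℰp K₀ (K₀ + 1) (Nat.le_succ K₀) (GaugeField.gaugeAct (fun x => (v x)⁻¹ * g x) U'') =
          GaugeField.gaugeAct w' (descendTo F ℰp K₀ (K₀ + 1) (Nat.le_succ K₀) U'') := by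
        rw [descendTo_succ, descendTo_succ]
        exact ((congrArg (fieldShift _) hcov).trans (gaugeAct_fieldShift _ w' _).symm)
      calc descendTo F ℰp J (K₀ + 1) hJK (GaugeField.gaugeAct (fun x => (v x)⁻¹ * g x) U'')
          = descendTo F ℰp J K₀ hJK₀ (descendTo F ℰp K₀ (K₀ + 1) (Nat.le_succ K₀) (GaugeField.gaugeAct (fun x => (v x)⁻¹ * g x) U'')) := by
            rw [descendTo_descendTo]
        _ = descendTo F ℰp J K₀ hJK₀ (GaugeField.gaugeAct w' (descendTo F ℰp K₀ (K₀ + 1) (Nat.le_succ K₀) U'')) := by rw [hstep]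
        _ = descendTo F ℰp J K₀ hJK₀ (descendTo F ℰp K₀ (K₀ + 1) (Nat.le_succ K₀) U'') := hres' _
        _ = descendTo F ℰp J (K₀ + 1) hJK U'' := by rw [descendTo_descendTo]
    · -- the bound
      have hconj : ∀ ℓ : PBond (F.P (K₀ + 1)) 0,
          dist1 (U ℓ * ((GaugeField.gaugeAct (fun x => (v x)⁻¹ * g x) (1 : GaugeField (F.P (K₀ + 1)) 0 (Matrix.specialUnitaryGroup (Fin 2) ℂ))) ℓ)⁻¹) =
          dist1 (W ℓ * (Y ℓ)⁻¹) := by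
        intro ℓ
        have e : U ℓ * ((GaugeField.gaugeAct (fun x => (v x)⁻¹ * g x) (1 : GaugeField (F.P (K₀ + 1)) 0 (Matrix.specialUnitaryGroup (Fin 2) ℂ))) ℓ)⁻¹ =
            (v ℓ.src)⁻¹ * (W ℓ * (Y ℓ)⁻¹) * ((v ℓ.src)⁻¹)⁻¹ := by
          rw [hW, hY]
          show U ℓ * ((v ℓ.src)⁻¹ * g ℓ.src * 1 * ((v ℓ.tgt)⁻¹ * g ℓ.tgt)⁻¹)⁻¹ =
            (v ℓ.src)⁻¹ * ((v ℓ.src * U ℓ * (v ℓ.tgt)⁻¹) * (g ℓ.src * 1 * (g ℓ.tgt)⁻¹)⁻¹) * ((v ℓ.src)⁻¹)⁻¹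
          group
        rw [e, GaugeGroup.dist1_conj]
      rw [Finset.sum_congr rfl fun ℓ _ => by rw [hconj ℓ]]
      have hA0 : 0 ≤ wilsonAction4 U := wilsonAction4_nonneg U
      have hCsq0 : (0 : ℝ) ≤ (2 * (((3 : ℕ) : ℝ) * (F.L : ℝ)) ^ 2 + 2 * (6 * ((((3 + 2) * F.L : ℕ) : ℝ) ^ 2 / 4)) + ((3 * ((F.L - 1) / 2) : ℕ) : ℝ) * (4 * (((3 : ℕ) : ℝ) * (F.L : ℝ)) ^ 2 + 2)) ^ 2 := by positivity
      have hMr0 : (0 : ℝ) ≤ ((3 * (2 * (2 * 3 * F.L + F.L + 3 * F.L) + 1) ^ 3 : ℕ) : ℝ) := Nat.cast_nonneg _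
      have hNBr0 : (0 : ℝ) ≤ ((3 * (2 * (3 * F.L) + 1) ^ 3 : ℕ) : ℝ) := Nat.cast_nonneg _
      have hcA0 : (0 : ℝ) ≤ ((2 : ℕ) : ℝ) * (((F.L : ℝ) ^ 2 + 6 * (((3 + 2) * F.L : ℕ) : ℝ) ^ 2) ^ 2 * ((3 ^ 2 * (2 * 3 + 1) ^ 3 : ℕ) : ℝ)) :=
        mul_nonneg (Nat.cast_nonneg _) (mul_nonneg (sq_nonneg _) (Nat.cast_nonneg _))
      exact step_arith m hCsq0 hMr0 hNBr0 hcA0 hA0 hpair hmis hplaq hA'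

end Tower

end Summit.QuantumFields.YangMills.Theorems.FluctuationComparisonRegPrIntLS2BetaFlatTubeTowerStep

end
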